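import Mathlib
import Summits.ResolutionOfSingularities.ResolutionOfSingularities.Theorems.WildQuotientsWildQuotientResolutionS1aInducedTorusRing

/-!
# The induced-torus ring: homogeneous units in all degrees `e • χ` and the degree-`0` part
(crux stmt-ResolutionOfSingularities-17941 `WildQuotients.CyclicQuotientFourfolds`, line B `s1a-tamebr`, (S1)
`S1.TameToBR.InducedTorusStatement`; plan-1 ASSIGN 2026-08-27T19:48:55Z. [OURS · L1 W4.5c] — NOT statements of
the manuscript; counted 0. Owner res-L1-w45c-stub-4 (gen 5).)

* `InducedTorus.inv_mem_of_isUnit` — in a ring graded by an abelian group, the inverse of a homogeneous unit of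
  degree `d` is homogeneous of degree `−d`;
* `InducedTorus.exists_unit_of_mem_closure` — homogeneous units in finitely many degrees `s` give homogeneous
  units in every degree of `AddSubgroup.closure s`;
* `InducedTorus.exists_unit_grade_nsmul` — with `e := (closure s).index` (finite index), the induced-torus ring
  `R` has a unit in `grade (e • χ)` for EVERY `χ : ℤᵐ` (`e • (χ mod r) ∈ closure s` by Lagrange);
* `InducedTorus.zeroEquiv : ↥(grade r 𝒜 0) ≃ₐ[k] ↥(𝒜 0)` — the degree-`0` part of `R` is `𝒜 0`.
-/

set_option linter.dupNamespace false

noncomputable section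

open DirectSum

namespace Summit.ResolutionOfSingularities.ResolutionOfSingularities.Theorems.WildQuotientResolution.S1.InducedTorus

/-! ## Homogeneous units -/

variable {m : ℕ} (r : Fin m → ℕ) {k : Type} [Field k] {B : Type} [CommRing B] [Algebra k B]
  (𝒜 : (Π j : Fin m, ZMod (r j)) → Submodule k B) [GradedAlgebra 𝒜]

/-- **The inverse of a homogeneous unit is homogeneous** (of the opposite degree). [folklore] -/
theorem inv_mem_of_isUnit {d : Π j : Fin m, ZMod (r j)} {u : B} (hu : IsUnit u) (hd : u ∈ 𝒜 d) : (↑hu.unit⁻¹ : B) ∈ 𝒜 (-d) := by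
  classical
  set v : B := ↑hu.unit⁻¹ with hv
  have huv : u * v = 1 := by rw [hv]; exact hu.mul_val_inv
  -- every component of `v` of degree `c ≠ -d` vanishes: `u · v_c` is the `(d + c)`-component of `1`
  have hcomp : ∀ c, c ≠ -d → (decompose 𝒜 v c : B) = 0 := by
    intro c hc
    have h1 : (decompose 𝒜 (u * v) (d + c) : B) = u * decompose 𝒜 v c :=
      coe_decompose_mul_add_of_left_mem 𝒜 (i := d) (j := c) hd
    rw [huv, decompose_of_mem_ne 𝒜 (SetLike.one_mem_graded 𝒜)
      (fun h => hc (eq_neg_of_add_eq_zero_right h.symm))] at h1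
    exact (hu.mul_right_eq_zero).mp h1.symm
  have hsum := sum_support_decompose 𝒜 v
  rw [Finset.sum_eq_single (-d) (fun c _ hc => hcomp c hc) (fun h => by
    simp only [DFinsupp.mem_support_toFun, ne_eq, not_not] at h; rw [h]; rfl)] at hsum
  rw [← hsum]
  exact (decompose 𝒜 v (-d)).2

/-- Existential form: a homogeneous unit has a homogeneous inverse of the opposite degree. [folklore] -/
theorem exists_inv_mem_of_isUnit {d : Π j : Fin m, ZMod (r j)} {u : B} (hu : IsUnit u) (hd : u ∈ 𝒜 d) :
    ∃ v : B, u * v = 1 ∧ v ∈ 𝒜 (-d) :=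
  ⟨↑hu.unit⁻¹, hu.mul_val_inv, inv_mem_of_isUnit r 𝒜 hu hd⟩

/-- **Units in every degree of the generated subgroup**: if `𝒜 d` contains a unit for every `d ∈ s`, then so does
`𝒜 d` for every `d ∈ AddSubgroup.closure s`. [OURS · L1 W4.5c] -/
theorem exists_unit_of_mem_closure (s : Set (Π j : Fin m, ZMod (r j))) (hs : ∀ d ∈ s, ∃ u : B, IsUnit u ∧ u ∈ 𝒜 d)
    {d : Π j : Fin m, ZMod (r j)}
    (hd : d ∈ AddSubgroup.closure s) : ∃ u : B, IsUnit u ∧ u ∈ 𝒜 d := by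
  induction hd using AddSubgroup.closure_induction with
  | mem x hx => exact hs x hx
  | zero => exact ⟨1, isUnit_one, SetLike.one_mem_graded 𝒜⟩
  | add x y _ _ hx hy =>
    obtain ⟨u, hu, hux⟩ := hx
    obtain ⟨v, hv, hvy⟩ := hy
    exact ⟨u * v, hu.mul hv, SetLike.mul_mem_graded hux hvy⟩
  | neg x _ hx =>
    obtain ⟨u, hu, hux⟩ := hx
    exact ⟨↑hu.unit⁻¹, Units.isUnit _, inv_mem_of_isUnit r 𝒜 hu hux⟩

/-! ## Units of the induced-torus ring -/

-- unification of the direct-sum ring structures is slow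
set_option maxHeartbeats 800000 in
/-- A homogeneous element of `B` of degree `λ mod r` with a homogeneous inverse of the opposite degree gives a
unit of the induced-torus ring in `grade λ`. [OURS · L1 W4.5c] -/
theorem exists_unit_grade_of_mul_eq_one (l : Fin m → ℤ) (u v : B) (huv : u * v = 1)
    (hul : u ∈ 𝒜 (torusDeg r l)) (hw : v ∈ 𝒜 (-torusDeg r l)) :
    ∃ U : InducedRing r 𝒜, U ∈ grade r 𝒜 l ∧ IsUnit U := by
  obtain ⟨a, rfl⟩ : ∃ a : ↥(pull r 𝒜 l), (a : B) = u := ⟨⟨u, hul⟩, rfl⟩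
  obtain ⟨b, rfl⟩ : ∃ b : ↥(pull r 𝒜 (-l)), (b : B) = v :=
    ⟨⟨v, by rw [mem_pull_iff, map_neg]; exact hw⟩, rfl⟩
  have key : GradedMonoid.mk (A := fun μ => ↥(pull r 𝒜 μ)) (l + -l)
        (@GradedMonoid.GMul.mul _ (fun μ => ↥(pull r 𝒜 μ)) _ _ l (-l) a b) =
      GradedMonoid.mk (A := fun μ => ↥(pull r 𝒜 μ)) 0 (@GradedMonoid.GOne.one _ (fun μ => ↥(pull r 𝒜 μ)) _ _) :=
    Sigma.subtype_ext (add_neg_cancel l) huv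
  have hprod : DirectSum.of (fun μ => ↥(pull r 𝒜 μ)) l a * DirectSum.of (fun μ => ↥(pull r 𝒜 μ)) (-l) b = 1 :=
    (DirectSum.of_mul_of (A := fun μ => ↥(pull r 𝒜 μ)) a b).trans
      ((DirectSum.of_eq_of_gradedMonoid_eq key).trans (DirectSum.one_def _).symm)
  refine ⟨DirectSum.of (fun μ => ↥(pull r 𝒜 μ)) l a, of_mem_grade r 𝒜 l a, ?_⟩
  exact isUnit_iff_exists_inv.mpr ⟨_, hprod⟩

/-- A homogeneous unit of `B` of degree `λ mod r` gives a unit of the induced-torus ring in `grade λ`.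
[OURS · L1 W4.5c] -/
theorem exists_unit_grade_of_unit (l : Fin m → ℤ) (u : B) (hu : IsUnit u) (hul : u ∈ 𝒜 (torusDeg r l)) :
    ∃ U : InducedRing r 𝒜, U ∈ grade r 𝒜 l ∧ IsUnit U := by
  obtain ⟨v, huv, hv⟩ := exists_inv_mem_of_isUnit r 𝒜 hu hul
  exact exists_unit_grade_of_mul_eq_one r 𝒜 l u v huv hul hv

/-- **Units in all degrees `e • χ`.** If `𝒜 d` contains a unit for every `d` in a finite set `s` generating a
subgroup of finite index `e`, then the induced-torus ring has a unit in `grade (e • χ)` for every `χ : ℤᵐ`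
(`e • (χ mod r)` lies in the subgroup by Lagrange). [OURS · L1 W4.5c] -/
theorem exists_unit_grade_nsmul (s : Finset (Π j : Fin m, ZMod (r j)))
    (hs : ∀ d ∈ s, ∃ u : B, IsUnit u ∧ u ∈ 𝒜 d) (χ : Fin m → ℤ) :
    ∃ U ∈ grade r 𝒜 ((AddSubgroup.closure (s : Set (Π j : Fin m, ZMod (r j)))).index • χ), IsUnit U := by
  set H := AddSubgroup.closure (s : Set (Π j : Fin m, ZMod (r j)))
  have hmem : torusDeg r (H.index • χ) ∈ H := by
    rw [map_nsmul]; exact AddSubgroup.nsmul_index_mem H _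
  have hs' : ∀ d ∈ (s : Set (Π j : Fin m, ZMod (r j))), ∃ u : B, IsUnit u ∧ u ∈ 𝒜 d :=
    fun d hd => hs d (Finset.mem_coe.mp hd)
  obtain ⟨u, hu, hud⟩ := exists_unit_of_mem_closure r 𝒜 (s : Set (Π j : Fin m, ZMod (r j))) hs' hmem
  exact exists_unit_grade_of_unit r 𝒜 (H.index • χ) u hu hud

/-! ## The degree-`0` part -/

/-- The degree-`0` part of `B` embeds in the degree-`0` part of the induced-torus ring. [OURS · L1 W4.5c] -/
def zeroHom : ↥(𝒜 0) →ₐ[k] ↥(grade r 𝒜 0) where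
  toFun a := ⟨DirectSum.of (fun μ => ↥(pull r 𝒜 μ)) 0 ⟨a.1, by rw [mem_pull_iff, map_zero]; exact a.2⟩,
    of_mem_grade r 𝒜 0 _⟩
  map_one' := Subtype.ext (by
    change DirectSum.of (fun μ => ↥(pull r 𝒜 μ)) 0 _ = 1
    rw [← DirectSum.of_zero_one]; rfl)
  map_mul' a b := Subtype.ext (by
    change DirectSum.of (fun μ => ↥(pull r 𝒜 μ)) 0 _ =
      DirectSum.of (fun μ => ↥(pull r 𝒜 μ)) 0 _ * DirectSum.of (fun μ => ↥(pull r 𝒜 μ)) 0 _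
    rw [← DirectSum.of_zero_mul]; rfl)
  map_zero' := Subtype.ext (by
    change DirectSum.of (fun μ => ↥(pull r 𝒜 μ)) 0 _ = 0
    rw [← map_zero (DirectSum.of (fun μ => ↥(pull r 𝒜 μ)) 0)]; rfl)
  map_add' a b := Subtype.ext (by
    change DirectSum.of (fun μ => ↥(pull r 𝒜 μ)) 0 _ =
      DirectSum.of (fun μ => ↥(pull r 𝒜 μ)) 0 _ + DirectSum.of (fun μ => ↥(pull r 𝒜 μ)) 0 _
    rw [← map_add]; rfl)
  commutes' c := Subtype.ext (by
    change DirectSum.of (fun μ => ↥(pull r 𝒜 μ)) 0 _ = algebraMap k (InducedRing r 𝒜) c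
    rw [DirectSum.algebraMap_apply]; rfl)

/-- `zeroHom` is bijective. [OURS · L1 W4.5c] -/
theorem zeroHom_bijective : Function.Bijective (zeroHom r 𝒜) := by
  constructor
  · intro a b h
    have h1 := congrArg (fun x : ↥(grade r 𝒜 0) => (x : InducedRing r 𝒜)) h
    have h2 := DirectSum.of_injective (β := fun μ => ↥(pull r 𝒜 μ)) 0 h1
    have h3 := congrArg Subtype.val h2
    exact Subtype.ext h3
  · rintro ⟨x, hx⟩
    obtain ⟨a, rfl⟩ := (mem_grade_iff r 𝒜 0 x).mp hx
    have ha : (a : B) ∈ 𝒜 0 := by have := a.2; rwa [mem_pull_iff, map_zero] at this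
    exact ⟨⟨a, ha⟩, rfl⟩

/-- **The degree-`0` part of the induced-torus ring is `𝒜 0`.** [OURS · L1 W4.5c] -/
def zeroEquiv : ↥(grade r 𝒜 0) ≃ₐ[k] ↥(𝒜 0) :=
  (AlgEquiv.ofBijective (zeroHom r 𝒜) (zeroHom_bijective r 𝒜)).symm

end Summit.ResolutionOfSingularities.ResolutionOfSingularities.Theorems.WildQuotientResolution.S1.InducedTorus

end
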